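import Summits.BirchSwinnertonDyer.Rank1Residual.Additive.GordTwistDegreeIdentity
import Summits.BirchSwinnertonDyer.Rank1Residual.Additive.GordTwistMinimalModel
import Summits.BirchSwinnertonDyer.Rank1Residual.Additive.GordIsogenyInvarianceClasses
import Summits.BirchSwinnertonDyer.Rank1Residual.Additive.GordManinConstantDegree
import HarnessLib

/-!
# X3/X4 at an additive prime: THE MANIN BINDER FROM TWO DEGREES — the `p`-adic twist identity
# `v_p(deg♭) + 2 v_p(c) = v_p(deg) + 2 v_p(c♭) + 1`, the STARRED types at `p ∈ {5, 7}`
# (Česnavičius–Neururer–Saha) and Edixhoven's exception locus at `p ≥ 11`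

HONEST FRAMING (cell `b2b-bsdres`, run/shared/lean/b2b/bsd-rank1-residual/, verbatim in every
file): the goal of the cell is to DELETE the COMBINATION-SHAPED residual classes of the
Birch–Swinnerton-Dyer formula for ALL analytic-rank `≤ 1` elliptic curves over `ℚ` — "full BSD
formula for every rank `≤ 1` curve in class `C`" assembled STRICTLY from published theorems — so
that the rank-`≤ 1` remainder becomes exactly the CONSTRUCTION-SHAPED classes, which are TYPED
(missing-input `Prop`s), NOT attempted. This is not "finishing BSD". Sub-cell `additive-p2`
(CLASS-OWNERS row "X3/X4 additive — pot. good ordinary / X3♯(G-ord)"), generation 17: research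
route; no claim beyond the stated classes; theorems only, no definition, no new named fact (the
published facts enter as hypotheses: `hCNS` = A159 Česnavičius–Neururer–Saha 2024 Thm. 1.2,
`hEdxK` = Edixhoven 1991 Thm. 3 in the Kodaira transcription p239550, and the cell's standing
binders `hKim`, `hGZ`, `hKo`, `hB`, `hGZK`, `hmod`, `hnf`, `hFH`); X3♯(G-ord)/X4♯(G-ord) stay
CONSTRUCTION-SHAPED; no label moves; nothing is booked.

WHAT THIS FILE DOES. Generation 16 (`GordManinConstantDegree.lean`; AUDIT-X34-GORD §4 R12) replaced
the Manin datum `p ∤ c(D)` of every Kim / Kato / Kolyvagin consumer of the cell by ONE class integer,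
`p ∤ deg(D)` (Česnavičius–Neururer–Saha: `val_p(c) ≤ val_p(deg)`), and recorded what stays
database-only: **the STARRED potentially good types (IV*, III*, II*) at `p ∈ {5, 7}`, where
`p ∣ deg` ALWAYS** (census gen16 T1–T5: `0 %` free; `17 303` binder-complete rank-`0` pairs at
`N > 130 000`), and the `p ∣ deg` rows of Edixhoven's exception locus at `p ≥ 11`. This file reads
the twist identity of `GordTwistDegreeIdentity.lean` — `p · deg(D) · c(D♭)² = deg(D♭) · u² · c(D)²`
for a pair `(V, p)` of UNSTARRED type and the globally minimal model `W` of its `p*`-twist (STARRED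
type), `D`, `D♭` conductor-level parametrisation data of `V`, `W` — `p`-adically
(`GordTwistMinimalModel.lean`: `ord_p u = 0`, `N(W) = N(V)`):
* §0 `unstarred_partner_of_twist_pStar` — the involution seen from the STARRED side: if `W` is
  additive, potentially good with `6 < ord_p Δ_min(W)` and `C • V^{(p*)} = W` (`V` globally minimal),
  then `V` is additive, potentially good, with `ord_p Δ_min(V) + 6 = ord_p Δ_min(W)` (so UNSTARRED).
* §1 **`padicVal_twist_identity`: `v_p(deg D♭) + 2·v_p(c(D)) = v_p(deg D) + 2·v_p(c(D♭)) + 1`** for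
  `D : ModularParametrizationData V N(V)`, `D♭ : ModularParametrizationData W N(W)`, ANY data (no
  optimality) — whence `p ∣ deg(D) · deg(D♭)` and `v_p(deg D) + v_p(deg D♭)` is ODD
  (`odd_padicValNat_modularDegree_add`): the census fact "`p ∣ deg` on one side of every twist
  pair" is a theorem.
* §2 (Česnavičius–Neururer–Saha, EVERY `p ≥ 5`, NO optimality): if `p ∤ deg(D)` then
  `v_p(deg D♭) = 2·v_p(c(D♭)) + 1` (`padicValNat_modularDegree_twist_eq_of_not_dvd`) — so `p ∣ deg(D♭)`
  (the census's "starred ⟹ `p ∣ deg`", `dvd_modularDegree_twist_of_not_dvd`) — and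
  **`p ∤ deg(D) ∧ p² ∤ deg(D♭) ⟹ p ∤ c(D♭)`** (`Addv.not_dvd_maninConstant_twist_of_not_dvd_of_not_sq_dvd`):
  THE MANIN DATUM OF A STARRED PAIR FROM TWO DEGREES. Starred-side form with only `W`-hypotheses
  plus the partner's datum: `Addv.not_dvd_maninConstant_of_twistDegrees`.
* §3 (Edixhoven, `p ≥ 11`): if `D♭` is STRONG (`Λ_W ⊆ c♭·Λ_{f♭}`, `W` optimal) then `p ∤ c(D♭)`
  (gen 14, starred type) and **`2·v_p(c(D)) + v_p(deg D♭) = v_p(deg D) + 1`**: on Edixhoven's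
  exception locus (unstarred (G-ord) `V`) the Manin valuation of ANY datum of `V` is decided by two
  degrees — `p ∣ c(D) ⟺ v_p(deg D♭) + 1 = v_p(deg D)`, `p ∤ c(D) ⟺ v_p(deg D♭) = v_p(deg D) + 1`
  (`…iff_of_strong_twist`); and `v_p(deg D♭) ≤ v_p(deg D) + 1`.
* The class-X4 consumers for the STARRED member (Kim 2026 rank `0`; both ranks from the lower halves
  of the same-`j` X4 pairs) with the Manin datum supplied by §2 are in the sibling file
  `GordManinConstantTwistDegreeConsumers.lean`.
EFFECT (binder bookkeeping; census `HOME/b2b-bsdres-additive-p2/census/gen17/`): on the starred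
(G-ord) types at `p ∈ {5, 7}` the Manin datum moves from Cremona's `c = 1` to "theorem + two class
integers" on every pair whose unstarred twist-partner is degree-free (by the gen-16 law
`deg♭ = p·deg`, exactly those); inside Edixhoven's exception locus at `p ≥ 11` the `p ∣ deg` rows
are decided by the twist's degree when the twist is optimal. The located gap (the LOWER half /
`CycLeadingTermAt` on defect 3,4,6 / Delbourgo's MC (G)) is untouched: labels UNCHANGED; nothing
booked.

References: K. Česnavičius, M. Neururer, A. Saha, J. Eur. Math. Soc. 26 (2024) Thm. 1.2
[CesnaviciusNeururerSaha2023]; B. Edixhoven, Progr. Math. 89 (1991) Thm. 3 [EdixhovenManin1991];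
D. Zagier, Canad. Math. Bull. 28 (1985) §1 [ZagierCMB1985]; C.-H. Kim, Amer. J. Math. 148 (2026)
Thm. 1.8 [Kim2022StructureSelmer]; J. E. Cremona, *Algorithms* §2.10 [CremonaAlgorithms1997];
J. H. Silverman, *ATAEC* IV Table 4.1 [SilvermanATAEC1994].
-/

noncomputable section

open scoped Classical NumberField

open WeierstrassCurve IsDedekindDomain IsDedekindDomain.HeightOneSpectrum NumberField
  Rat.HeightOneSpectrum Literature.NumberTheory.EllipticCurves
  Literature.NumberTheory.EllipticCurves.ModularForms
  Literature.NumberTheory.EllipticCurves.Rank1Residual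
  Literature.NumberTheory.EllipticCurves.Rank1Residual.Typed
  Literature.NumberTheory.DiophantineGeometry

namespace Summit.BirchSwinnertonDyer.Rank1Residual.Additive

variable (p : ℕ) [hp : Fact p.Prime]

/-! ### §0 The involution from the starred side -/

/-- **`ord_p Δ_min` across a `p*`-twist, with the scaling**: for `C • V^{(p*)} = W` (`V, W` globally
minimal, any prime `p`), `ord_p Δ_min(W) = ord_p Δ_min(V) + 6 − 12·ord_p u(C)`
(`Δ(C • X) = u⁻¹² Δ(X)`, `Δ(V^{(d)}) = d⁶ Δ(V)`). [cite: SilvermanAEC2009, III.1 Table 3.1 (PDF p. 50)] -/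
theorem padicValInt_minimalDiscriminantInt_twist_pStar_eq (V W : WeierstrassCurve ℚ)
    [V.IsElliptic] [V.IsGloballyMinimal] [W.IsElliptic] [W.IsGloballyMinimal] (C : VariableChange ℚ)
    (hC : C • V.quadraticTwist ((-1 : ℚ) ^ (p / 2) * p) = W) :
    (padicValInt p W.minimalDiscriminantInt : ℤ) =
      padicValInt p V.minimalDiscriminantInt + 6 - 12 * padicValRat p (C.u : ℚ) := by
  obtain ⟨hcast, hd⟩ := pStar_intCast p
  set d : ℤ := (-1 : ℤ) ^ (p / 2) * p with hddef
  rw [← hcast] at hC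
  have hu0 : (C.u : ℚ) ≠ 0 := C.u.ne_zero
  have hd0 : (d : ℚ) ≠ 0 := by
    rcases hd with h | h <;> rw [h] <;> push_cast <;> simp [hp.out.ne_zero]
  have hVΔ : (V.minimalDiscriminantInt : ℚ) ≠ 0 := by exact_mod_cast V.minimalDiscriminantInt_ne_zero
  have hdv : padicValRat p (d : ℚ) = 1 := by
    rcases hd with h | h <;> rw [h]
    · push_cast; exact_mod_cast padicValRat.self hp.out.one_lt
    · push_cast; rw [padicValRat.neg]; exact_mod_cast padicValRat.self hp.out.one_lt
  have hΔ : (W.minimalDiscriminantInt : ℚ) =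
      (C.u : ℚ)⁻¹ ^ 12 * ((d : ℚ) ^ 6 * V.minimalDiscriminantInt) := by
    rw [cast_minimalDiscriminantInt, cast_minimalDiscriminantInt, ← hC, variableChange_Δ,
      quadraticTwist_Δ, Units.val_inv_eq_inv_val]
  have key : (padicValInt p W.minimalDiscriminantInt : ℤ) =
      padicValRat p ((C.u : ℚ)⁻¹ ^ 12 * ((d : ℚ) ^ 6 * V.minimalDiscriminantInt)) := by
    rw [← padicValRat.of_int, hΔ]
  rw [padicValRat.mul (pow_ne_zero _ (inv_ne_zero hu0)) (mul_ne_zero (pow_ne_zero _ hd0) hVΔ),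
    padicValRat.mul (pow_ne_zero _ hd0) hVΔ, padicValRat.pow, padicValRat.pow, padicValRat.inv,
    hdv, padicValRat.of_int] at key
  simp only [Nat.cast_ofNat, mul_one] at key
  linarith

/-- **The involution from the STARRED side.** Let `W/ℚ` be globally minimal, ADDITIVE and potentially
good at `p ≥ 5` (`0 ≤ ord_p j`) of STARRED type (`6 < ord_p Δ_min(W)`, i.e. IV* / III* / II*), and
let `V` be any globally minimal model with `C • V^{(p*)} = W`. Then `V` is additive and potentially
good at `p` with **`ord_p Δ_min(V) + 6 = ord_p Δ_min(W)`** — `V` is of the UNSTARRED type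
II / III / IV. Proof: `j(V) = j(W)`; `ord_p Δ_min(W) = ord_p Δ_min(V) + 6 − 12 ord_p u`; `V` good
would give `ord_p Δ_min(W) ≡ 6 (mod 12)`; so `V` is additive, its `ord_p Δ_min ∈ {2,…,10}` (gen 15's
`padicValInt_minimalDiscriminantInt_mem_of_addv_of_padicValRat_j_nonneg`), and `ord_p u = 0`.
[cite: SilvermanATAEC1994, IV Table 4.1 (PDF p. 365)] -/
theorem unstarred_partner_of_twist_pStar (hp5 : 5 ≤ p) (V W : WeierstrassCurve ℚ) [V.IsElliptic]
    [V.IsGloballyMinimal] [W.IsElliptic] [W.IsGloballyMinimal] (hW : Addv W p)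
    (hjW : 0 ≤ padicValRat p W.j) (h6 : 6 < padicValInt p W.minimalDiscriminantInt)
    (C : VariableChange ℚ) (hC : C • V.quadraticTwist ((-1 : ℚ) ^ (p / 2) * p) = W) :
    Addv V p ∧ 0 ≤ padicValRat p V.j ∧
      padicValInt p V.minimalDiscriminantInt + 6 = padicValInt p W.minimalDiscriminantInt := by
  have hd0 : ((-1 : ℚ) ^ (p / 2) * p) ≠ 0 := pStar_ne_zero p
  haveI : (V.quadraticTwist ((-1 : ℚ) ^ (p / 2) * p)).IsElliptic := V.isElliptic_quadraticTwist hd0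
  have hrel := padicValInt_minimalDiscriminantInt_twist_pStar_eq p V W C hC
  have hjV : V.j = W.j := by
    subst hC
    rw [variableChange_j, V.j_quadraticTwist hd0]
  have hjV' : 0 ≤ padicValRat p V.j := hjV ▸ hjW
  have hvW := padicValInt_minimalDiscriminantInt_mem_of_addv_of_padicValRat_j_nonneg W p hp5 hW hjW
  -- the scaling valuation is an integer
  obtain ⟨m, hm⟩ : ∃ m : ℤ, padicValRat p (C.u : ℚ) = m := ⟨_, rfl⟩
  rw [hm] at hrel
  -- `V` is not good at `p`
  have hngood : ¬ Good V p := by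
    intro hgood
    have h0 : padicValInt p V.minimalDiscriminantInt = 0 :=
      padicValInt.eq_zero_of_not_dvd (EisensteinPrimes.not_dvd_disc_of_good V p hgood)
    rw [h0] at hrel
    omega
  have hnmult : ¬ Mult V p := fun hmult ↦
    not_lt.mpr hjV' (EisensteinPrimes.padicValRat_j_neg_of_mult V p hmult)
  have hV : Addv V p := ⟨hngood, hnmult⟩
  have hvV := padicValInt_minimalDiscriminantInt_mem_of_addv_of_padicValRat_j_nonneg V p hp5 hV hjV'
  refine ⟨hV, hjV', ?_⟩
  omega

/-! ### §1 The `p`-adic twist identity at the conductor levels -/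

omit hp in
/-- Arithmetic bridge: from `p · deg · c♭² = deg♭ · u² · c²` in `ℚ` with `ord_p u = 0` (all factors
non-zero) to `v_p(deg♭) + 2 v_p(c) = v_p(deg) + 2 v_p(c♭) + 1`. [folklore] -/
theorem padicVal_identity_of_rat_identity [Fact p.Prime] {deg deg' : ℕ} {c c' : ℤ} {u : ℚ}
    (hdeg : 0 < deg) (hdeg' : 0 < deg') (hc : c ≠ 0) (hc' : c' ≠ 0) (hu0 : u ≠ 0)
    (hu : padicValRat p u = 0)
    (h : (p : ℚ) * deg * (c' : ℚ) ^ 2 = deg' * u ^ 2 * (c : ℚ) ^ 2) :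
    padicValNat p deg' + 2 * padicValInt p c = padicValNat p deg + 2 * padicValInt p c' + 1 := by
  have hP : (Fact.out : p.Prime) = Fact.out := rfl
  have hpq : (p : ℚ) ≠ 0 := by exact_mod_cast (Fact.out : p.Prime).ne_zero
  have hdq : (deg : ℚ) ≠ 0 := by exact_mod_cast hdeg.ne'
  have hdq' : (deg' : ℚ) ≠ 0 := by exact_mod_cast hdeg'.ne'
  have hcq : (c : ℚ) ≠ 0 := by exact_mod_cast hc
  have hcq' : (c' : ℚ) ≠ 0 := by exact_mod_cast hc'
  have key := congrArg (padicValRat p) h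
  rw [padicValRat.mul (mul_ne_zero hpq hdq) (pow_ne_zero _ hcq'), padicValRat.mul hpq hdq,
    padicValRat.mul (mul_ne_zero hdq' (pow_ne_zero _ hu0)) (pow_ne_zero _ hcq),
    padicValRat.mul hdq' (pow_ne_zero _ hu0), padicValRat.pow, padicValRat.pow, padicValRat.pow, hu,
    padicValRat.self (Fact.out : p.Prime).one_lt, padicValRat.of_nat, padicValRat.of_nat,
    padicValRat.of_int, padicValRat.of_int] at key
  simp only [Nat.cast_ofNat, mul_zero, add_zero] at key
  omega

/-- **THE `p`-ADIC TWIST IDENTITY.** Let `p ≥ 5`, `V/ℚ` globally minimal, ADDITIVE and potentially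
good at `p` (`0 ≤ ord_p j`) with `ord_p Δ_min(V) < 6` (Kodaira II / III / IV), `W` a globally
minimal model of its `p*`-twist (`C • V^{(p*)} = W`), and `D`, `D♭` parametrisation data of `V`, `W`
at their conductor levels (ANY data — no optimality). Then
**`v_p(deg D♭) + 2·v_p(c(D)) = v_p(deg D) + 2·v_p(c(D♭)) + 1`.** Proof: `W` is additive at `p`
(`addv_of_twist_pStar`), `N(W) = N(V)` (`conductorNorm_eq_of_twist_pStar`) so both newforms are on
`Γ₀(N(V))` and the rational identity `p·deg·c♭² = deg♭·u²·c²` (`twist_modularDegree_identity`)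
applies, with `ord_p u = 0` (`padicValRat_u_eq_zero_and_padicValInt_eq_of_twist_pStar`).
[cite: ZagierCMB1985, §1 (p. 374)] [cite: SilvermanAEC2009, VII.1 Prop. 1.3(b)] -/
theorem padicVal_twist_identity (hp5 : 5 ≤ p) (V W : WeierstrassCurve ℚ) [V.IsElliptic]
    [V.IsGloballyMinimal] [W.IsElliptic] [W.IsGloballyMinimal] (hV : Addv V p)
    (hj : 0 ≤ padicValRat p V.j) (hV6 : padicValInt p V.minimalDiscriminantInt < 6)
    (C : VariableChange ℚ) (hC : C • V.quadraticTwist ((-1 : ℚ) ^ (p / 2) * p) = W)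
    [NeZero (V.conductorNorm ℤ)] [NeZero (W.conductorNorm ℤ)]
    (D : ModularParametrizationData V (V.conductorNorm ℤ))
    (D' : ModularParametrizationData W (W.conductorNorm ℤ)) :
    padicValNat p D'.modularDegree + 2 * padicValInt p D.maninConstant =
      padicValNat p D.modularDegree + 2 * padicValInt p D'.maninConstant + 1 := by
  have hp2 : p ≠ 2 := by omega
  obtain ⟨hW, -, -⟩ := addv_of_twist_pStar p hp2 V W hj hV6 C hC
  obtain ⟨hu, -⟩ := padicValRat_u_eq_zero_and_padicValInt_eq_of_twist_pStar p hp2 V W hV6 C hC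
  have hN : W.conductorNorm ℤ = V.conductorNorm ℤ := conductorNorm_eq_of_twist_pStar p hp5 V W hV hW C hC
  -- move `D'` to the common level `N(V)`
  have key : ∀ (N M : ℕ) [NeZero N] [NeZero M], M = N →
      ∀ (D₁ : ModularParametrizationData V N) (D₂ : ModularParametrizationData W M),
        (p : ℚ) * D₁.modularDegree * (D₂.maninConstant : ℚ) ^ 2 =
          D₂.modularDegree * (C.u : ℚ) ^ 2 * (D₁.maninConstant : ℚ) ^ 2 := by
    intro N M _ _ h D₁ D₂
    subst h
    exact twist_modularDegree_identity p hp2 V W hV hW C hC D₁ D₂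
  exact padicVal_identity_of_rat_identity p D.deg_pos D'.deg_pos D.maninConstant_ne_zero_holds
    D'.maninConstant_ne_zero_holds C.u.ne_zero hu (key _ _ hN D D')

/-- **`v_p(deg D) + v_p(deg D♭)` is ODD** — in particular one of the two degrees is divisible by
`p`: the census observation "across every unstarred/starred twist pair `p` divides a modular
degree" as a theorem (no optimality, no Manin input). [cite: ZagierCMB1985, §1 (p. 374)] -/
theorem odd_padicValNat_modularDegree_add (hp5 : 5 ≤ p) (V W : WeierstrassCurve ℚ) [V.IsElliptic]
    [V.IsGloballyMinimal] [W.IsElliptic] [W.IsGloballyMinimal] (hV : Addv V p)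
    (hj : 0 ≤ padicValRat p V.j) (hV6 : padicValInt p V.minimalDiscriminantInt < 6)
    (C : VariableChange ℚ) (hC : C • V.quadraticTwist ((-1 : ℚ) ^ (p / 2) * p) = W)
    [NeZero (V.conductorNorm ℤ)] [NeZero (W.conductorNorm ℤ)]
    (D : ModularParametrizationData V (V.conductorNorm ℤ))
    (D' : ModularParametrizationData W (W.conductorNorm ℤ)) :
    Odd (padicValNat p D.modularDegree + padicValNat p D'.modularDegree) ∧
      (p ∣ D.modularDegree ∨ p ∣ D'.modularDegree) := by
  have h := padicVal_twist_identity p hp5 V W hV hj hV6 C hC D D'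
  refine ⟨Nat.odd_iff.mpr (by omega), ?_⟩
  by_cases hd : p ∣ D.modularDegree
  · exact Or.inl hd
  · right
    have h0 : padicValNat p D.modularDegree = 0 := padicValNat.eq_zero_of_not_dvd hd
    refine (dvd_iff_padicValNat_ne_zero D'.deg_pos.ne').mpr ?_
    have : padicValNat p D'.modularDegree ≠ 0 := by omega
    exact this

/-! ### §2 Česnavičius–Neururer–Saha: the Manin datum of the STARRED pair from two degrees (every `p ≥ 5`) -/

/-- **If `p ∤ deg(D)` then `v_p(deg D♭) = 2·v_p(c(D♭)) + 1`** (`p ≥ 5`, hypotheses of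
`padicVal_twist_identity`; Česnavičius–Neururer–Saha on `D`: `v_p(c(D)) ≤ v_p(deg D) = 0`). The
valuation of the twist's degree is ODD and DETERMINES the Manin valuation of the twist's datum.
[cite: CesnaviciusNeururerSaha2023, Thm. 1.2] -/
theorem padicValNat_modularDegree_twist_eq_of_not_dvd
    (hCNS : cesnaviciusNeururerSaha_padicVal_maninConstant_le_modularDegree)
    (hp5 : 5 ≤ p) (V W : WeierstrassCurve ℚ) [V.IsElliptic]
    [V.IsGloballyMinimal] [W.IsElliptic] [W.IsGloballyMinimal] (hV : Addv V p)
    (hj : 0 ≤ padicValRat p V.j) (hV6 : padicValInt p V.minimalDiscriminantInt < 6)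
    (C : VariableChange ℚ) (hC : C • V.quadraticTwist ((-1 : ℚ) ^ (p / 2) * p) = W)
    [NeZero (V.conductorNorm ℤ)] [NeZero (W.conductorNorm ℤ)]
    (D : ModularParametrizationData V (V.conductorNorm ℤ))
    (D' : ModularParametrizationData W (W.conductorNorm ℤ)) (hdeg : ¬ p ∣ D.modularDegree) :
    padicValNat p D'.modularDegree = 2 * padicValInt p D'.maninConstant + 1 := by
  have h := padicVal_twist_identity p hp5 V W hV hj hV6 C hC D D'
  have h0 : padicValNat p D.modularDegree = 0 := padicValNat.eq_zero_of_not_dvd hdeg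
  have hle := padicVal_maninConstant_le_modularDegree_of_five_le hCNS V D hp.out hp5
  rw [h0] at hle h
  have hc0 : padicValInt p D.maninConstant = 0 := by omega
  omega

/-- **If `p ∤ deg(D)` then `p ∣ deg(D♭)`** — the census's "`p ∣ deg` ALWAYS on the starred types"
(gen16 T2: `0` exceptions) is a THEOREM on every pair whose unstarred partner is degree-free.
[cite: CesnaviciusNeururerSaha2023, Thm. 1.2] -/
theorem dvd_modularDegree_twist_of_not_dvd
    (hCNS : cesnaviciusNeururerSaha_padicVal_maninConstant_le_modularDegree)
    (hp5 : 5 ≤ p) (V W : WeierstrassCurve ℚ) [V.IsElliptic]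
    [V.IsGloballyMinimal] [W.IsElliptic] [W.IsGloballyMinimal] (hV : Addv V p)
    (hj : 0 ≤ padicValRat p V.j) (hV6 : padicValInt p V.minimalDiscriminantInt < 6)
    (C : VariableChange ℚ) (hC : C • V.quadraticTwist ((-1 : ℚ) ^ (p / 2) * p) = W)
    [NeZero (V.conductorNorm ℤ)] [NeZero (W.conductorNorm ℤ)]
    (D : ModularParametrizationData V (V.conductorNorm ℤ))
    (D' : ModularParametrizationData W (W.conductorNorm ℤ)) (hdeg : ¬ p ∣ D.modularDegree) :
    p ∣ D'.modularDegree := by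
  have h := padicValNat_modularDegree_twist_eq_of_not_dvd p hCNS hp5 V W hV hj hV6 C hC D D' hdeg
  refine (dvd_iff_padicValNat_ne_zero D'.deg_pos.ne').mpr ?_
  change padicValNat p D'.modularDegree ≠ 0
  omega

/-- **THE MANIN DATUM OF THE STARRED PAIR FROM TWO DEGREES: `p ∤ deg(D) ∧ p² ∤ deg(D♭) ⟹ p ∤ c(D♭)`**
(`p ≥ 5`; `V` unstarred additive potentially good, `W` its minimal `p*`-twist, `D`/`D♭` ANY
conductor-level data of `V`/`W` — NO optimality, NO Edixhoven, so `p ∈ {5, 7}` INCLUDED): by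
`padicValNat_modularDegree_twist_eq_of_not_dvd`, `v_p(deg D♭) = 2 v_p(c♭) + 1 ≤ 1`.
[cite: CesnaviciusNeururerSaha2023, Thm. 1.2] [cite: ZagierCMB1985, §1 (p. 374)] -/
theorem Addv.not_dvd_maninConstant_twist_of_not_dvd_of_not_sq_dvd
    (hCNS : cesnaviciusNeururerSaha_padicVal_maninConstant_le_modularDegree)
    (hp5 : 5 ≤ p) (V W : WeierstrassCurve ℚ) [V.IsElliptic]
    [V.IsGloballyMinimal] [W.IsElliptic] [W.IsGloballyMinimal] (hV : Addv V p)
    (hj : 0 ≤ padicValRat p V.j) (hV6 : padicValInt p V.minimalDiscriminantInt < 6)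
    (C : VariableChange ℚ) (hC : C • V.quadraticTwist ((-1 : ℚ) ^ (p / 2) * p) = W)
    [NeZero (V.conductorNorm ℤ)] [NeZero (W.conductorNorm ℤ)]
    (D : ModularParametrizationData V (V.conductorNorm ℤ))
    (D' : ModularParametrizationData W (W.conductorNorm ℤ)) (hdeg : ¬ p ∣ D.modularDegree)
    (hdeg' : ¬ p ^ 2 ∣ D'.modularDegree) : ¬ (p : ℤ) ∣ D'.maninConstant := by
  have h := padicValNat_modularDegree_twist_eq_of_not_dvd p hCNS hp5 V W hV hj hV6 C hC D D' hdeg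
  have hlt : padicValNat p D'.modularDegree < 2 := by
    by_contra hle
    exact hdeg' ((padicValNat_dvd_iff_le D'.deg_pos.ne').mpr (not_lt.mp hle))
  have hc0 : padicValInt p D'.maninConstant = 0 := by omega
  intro hdvd
  have hne : D'.maninConstant ≠ 0 := D'.maninConstant_ne_zero_holds
  rcases (padicValInt_dvd_iff (p := p) 1 D'.maninConstant).mp (by rwa [pow_one]) with h0 | h1
  · exact hne h0
  · omega

/-- **STARRED-SIDE FORM (hypotheses on the pair `(W, p)` only, plus the partner's datum).** Let `W/ℚ`
be globally minimal, ADDITIVE and potentially good at `p ≥ 5` of STARRED type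
(`6 < ord_p Δ_min(W)`: IV* / III* / II*), `D♭` a conductor-level parametrisation datum of `W` with
`p² ∤ deg(D♭)`; let `V` be ANY globally minimal model with `C • V^{(p*)} = W` (a minimal model of
`E ⊗ χ_{p*}`; it is unstarred, §0) carrying a conductor-level datum `D` with `p ∤ deg(D)`. Then
**`p ∤ c(D♭)`** — at EVERY `p ≥ 5`, with NO optimality hypothesis on either side. This is the R12
residual of AUDIT-X34-GORD ("the STARRED (G-ord) types at `p ∈ {5, 7}`, where `p ∣ deg` always")
discharged from two class integers. [cite: CesnaviciusNeururerSaha2023, Thm. 1.2]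
[cite: ZagierCMB1985, §1 (p. 374)] -/
theorem Addv.not_dvd_maninConstant_of_twistDegrees
    (hCNS : cesnaviciusNeururerSaha_padicVal_maninConstant_le_modularDegree)
    (hp5 : 5 ≤ p) (W : WeierstrassCurve ℚ) [W.IsElliptic] [W.IsGloballyMinimal]
    (hW : Addv W p) (hjW : 0 ≤ padicValRat p W.j) (h6 : 6 < padicValInt p W.minimalDiscriminantInt)
    [NeZero (W.conductorNorm ℤ)] (D' : ModularParametrizationData W (W.conductorNorm ℤ))
    (hdeg' : ¬ p ^ 2 ∣ D'.modularDegree)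
    (V : WeierstrassCurve ℚ) [V.IsElliptic] [V.IsGloballyMinimal] [NeZero (V.conductorNorm ℤ)]
    (C : VariableChange ℚ) (hC : C • V.quadraticTwist ((-1 : ℚ) ^ (p / 2) * p) = W)
    (D : ModularParametrizationData V (V.conductorNorm ℤ)) (hdeg : ¬ p ∣ D.modularDegree) :
    ¬ (p : ℤ) ∣ D'.maninConstant := by
  obtain ⟨hV, hjV, hvV⟩ := unstarred_partner_of_twist_pStar p hp5 V W hW hjW h6 C hC
  have hvW := padicValInt_minimalDiscriminantInt_mem_of_addv_of_padicValRat_j_nonneg W p hp5 hW hjW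
  have hV6 : padicValInt p V.minimalDiscriminantInt < 6 := by omega
  exact Addv.not_dvd_maninConstant_twist_of_not_dvd_of_not_sq_dvd p hCNS hp5 V W hV hjV hV6 C hC D D'
    hdeg hdeg'

/-! ### §3 Edixhoven (`p ≥ 11`): the exception locus decided by the twist's degree -/

/-- **If the twist `W` is `X₀`-OPTIMAL — `D♭` STRONG (`Λ_W ⊆ c♭·Λ_{f♭}`) — then `p ∤ c(D♭)` at
`p ≥ 11`** (`W` is of starred type, outside Edixhoven's exception: gen 14's
`Addv.not_dvd_maninConstant_of_four_lt`), **and the identity becomes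
`2·v_p(c(D)) + v_p(deg D♭) = v_p(deg D) + 1`** for EVERY conductor-level datum `D` of the unstarred
`V`. [cite: EdixhovenManin1991, Thm. 3] [cite: ZagierCMB1985, §1 (p. 374)] -/
theorem padicVal_twist_identity_of_strong_twist
    (hEdxK : edixhoven_not_dvd_maninConstant_of_kodairaSymbol_ne) (hp7 : 7 < p)
    (V W : WeierstrassCurve ℚ) [V.IsElliptic] [V.IsGloballyMinimal] [W.IsElliptic]
    [W.IsGloballyMinimal] (hV : Addv V p) (hj : 0 ≤ padicValRat p V.j)
    (hV6 : padicValInt p V.minimalDiscriminantInt < 6)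
    (C : VariableChange ℚ) (hC : C • V.quadraticTwist ((-1 : ℚ) ^ (p / 2) * p) = W)
    [NeZero (V.conductorNorm ℤ)] [NeZero (W.conductorNorm ℤ)]
    (D : ModularParametrizationData V (V.conductorNorm ℤ))
    (D' : ModularParametrizationData W (W.conductorNorm ℤ))
    (hopt' : ∀ z ∈ D'.L.lattice, ∃ w ∈ periodLattice D'.f, z = D'.c * w) :
    ¬ (p : ℤ) ∣ D'.maninConstant ∧
      2 * padicValInt p D.maninConstant + padicValNat p D'.modularDegree =
        padicValNat p D.modularDegree + 1 := by
  have hp5 : 5 ≤ p := by omega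
  have hp2 : p ≠ 2 := by omega
  obtain ⟨hW, -, -⟩ := addv_of_twist_pStar p hp2 V W hj hV6 C hC
  obtain ⟨-, hvW⟩ := padicValRat_u_eq_zero_and_padicValInt_eq_of_twist_pStar p hp2 V W hV6 C hC
  have hk0 : 0 ≤ padicValInt p V.minimalDiscriminantInt := by positivity
  have hne : Addv W p := hW
  have hc' : ¬ (p : ℤ) ∣ D'.maninConstant :=
    Addv.not_dvd_maninConstant_of_four_lt W p hEdxK D' hopt' hp7 hne (by omega)
  have h := padicVal_twist_identity p hp5 V W hV hj hV6 C hC D D'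
  have hc0 : padicValInt p D'.maninConstant = 0 := padicValInt.eq_zero_of_not_dvd hc'
  exact ⟨hc', by omega⟩

/-- **EDIXHOVEN'S EXCEPTION LOCUS DECIDED BY THE TWIST'S DEGREE** (`p ≥ 11`; `V` unstarred additive
potentially good — for (G)-ordinary `V` this is exactly the printed exception "potentially ordinary
of type II, III or IV" where only `p² ∤ c` is in print; `W` its minimal `p*`-twist with a STRONG
datum `D♭`, i.e. the twist is the optimal curve of its class; `D` ANY conductor-level datum of `V`):
**`p ∣ c(D) ⟺ v_p(deg D♭) < v_p(deg D)`** and **`p ∤ c(D) ⟺ v_p(deg D♭) = v_p(deg D) + 1`**;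
unconditionally `v_p(deg D♭) ≤ v_p(deg D) + 1` (with Edixhoven's printed "at most once", not
transcribed in the tree, the first case would read `v_p(deg D♭) + 1 = v_p(deg D)`).
[cite: EdixhovenManin1991, Thm. 3]
[cite: ZagierCMB1985, §1 (p. 374)] -/
theorem Addv.dvd_maninConstant_iff_of_strong_twist
    (hEdxK : edixhoven_not_dvd_maninConstant_of_kodairaSymbol_ne) (hp7 : 7 < p)
    (V W : WeierstrassCurve ℚ) [V.IsElliptic] [V.IsGloballyMinimal] [W.IsElliptic]
    [W.IsGloballyMinimal] (hV : Addv V p) (hj : 0 ≤ padicValRat p V.j)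
    (hV6 : padicValInt p V.minimalDiscriminantInt < 6)
    (C : VariableChange ℚ) (hC : C • V.quadraticTwist ((-1 : ℚ) ^ (p / 2) * p) = W)
    [NeZero (V.conductorNorm ℤ)] [NeZero (W.conductorNorm ℤ)]
    (D : ModularParametrizationData V (V.conductorNorm ℤ))
    (D' : ModularParametrizationData W (W.conductorNorm ℤ))
    (hopt' : ∀ z ∈ D'.L.lattice, ∃ w ∈ periodLattice D'.f, z = D'.c * w) :
    ((p : ℤ) ∣ D.maninConstant ↔ padicValNat p D'.modularDegree < padicValNat p D.modularDegree) ∧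
    (¬ (p : ℤ) ∣ D.maninConstant ↔ padicValNat p D'.modularDegree = padicValNat p D.modularDegree + 1) ∧
    padicValNat p D'.modularDegree ≤ padicValNat p D.modularDegree + 1 := by
  obtain ⟨-, h⟩ := padicVal_twist_identity_of_strong_twist p hEdxK hp7 V W hV hj hV6 C hC D D' hopt'
  have hne : D.maninConstant ≠ 0 := D.maninConstant_ne_zero_holds
  have hdvd : (p : ℤ) ∣ D.maninConstant ↔ 1 ≤ padicValInt p D.maninConstant := by
    rw [← pow_one (p : ℤ), padicValInt_dvd_iff]
    exact ⟨fun h' ↦ h'.resolve_left hne, Or.inr⟩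
  refine ⟨?_, ?_, by omega⟩
  · rw [hdvd]; omega
  · rw [hdvd]; omega

end Summit.BirchSwinnertonDyer.Rank1Residual.Additive

end
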